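import Mathlib
import Literature.Analysis.FluidPDE.LinearizedNSTorus
import HarnessLib

/-!
# Linear ⇒ nonlinear (Lyapunov) instability of steady states of the forced Navier–Stokes
system on `T³` (Friedlander–Pavlović–Shvydkoy 2006)

Definitions module + ONE named fact (no proof) for the cell `ns-blowup` (seat `instab`, memo
`INSTAB-BRIDGE.md` §10, rung R-α): the bridge from a CERTIFIED unstable eigenvalue of the
linearisation at an exact steady state (crux X0: the forced ABC flow at `R = 100`) to a statement
about the TRUE nonlinear dynamics near that steady state.

S. Friedlander, N. Pavlović, R. Shvydkoy, *Nonlinear instability for the Navier–Stokes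
equations*, Comm. Math. Phys. **264** (2006) 335–347 (arXiv:math/0508173), Theorem 2.2 (p. 4;
proof for `𝕋ⁿ` and bounded domains §3, pp. 6–7): *"Let `1 < p < ∞` be arbitrary. Suppose that the
operator `A` over `L^p` has spectrum in the right half of the complex plane. Then the flow `U₀` is
`(L^q, L^p)` nonlinearly unstable for any `q > max{p, n}`"*, where `A v = P[−(U₀·∇)v − (v·∇)U₀ +
R⁻¹Δv]` is the linearisation of the forced system `∂ₜq = −(q·∇)q − ∇p + R⁻¹Δq + f` at a smooth
steady solution `U₀` with smooth force `f` (their (2.1)–(2.5)), and `(X, Z)`-nonlinear stability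
(Def. 2.1) means: for every `ρ > 0` there is `δ > 0` such that `v₀ ∈ X`, `‖v₀‖_Z < δ` imply (i) a
global mild solution `v ∈ C([0,∞); X)` of the perturbation equation exists and (ii) `‖v(t)‖_Z < ρ`
for a.e. `t`; *"loss of existence of a solution is a particular case of instability"* (p. 4). On a
finite domain *"our method proves a stronger result. Since the eigenfunction `φ` belongs to `C^∞`,
the size of initial perturbation can be measured in the stronger metric of `C^∞`"* (p. 7; the
unstable datum of the proof is `v₀ = εφ`).

## What is stated here (tree vocabulary: the accepted torus calculus
`Literature.Analysis.FunctionSpaces.Torus.*` and the linearisation module `LinearizedNSTorus`)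

* `Torus.IsLyapunovUnstableSteadyState ν f u_S` — the CLASSICAL-SOLUTION, KINETIC-ENERGY form of
  FPS-instability of a steady state `u_S` of `NS_ν(f)` on `T³`: there is `ρ > 0` such that for every
  `δ > 0` some smooth divergence-free perturbation `v₀` with `E(v₀) = ½‖v₀‖²_{L²} < δ` has the
  property that EVERY global classical solution of `NS_ν(f)` starting from `u_S + v₀` reaches
  kinetic-energy distance `≥ ρ` from `u_S` at some time `t ≥ 0` (if no global classical solution
  exists the clause holds vacuously — FPS count loss of existence as instability). This is implied
  by `(L^q, L²)`-instability in the sense of Def. 2.1 with the `C^∞`-small datum of p. 7: a global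
  classical solution on the torus is a global mild solution in `C([0,∞); L^q)`.
* `fps2006_nonlinear_instability_of_eigenvalue` — THE NAMED FACT (Thm 2.2 with `n = 3`, `p = 2`,
  hypothesis specialised to an EIGENVALUE with positive real part — on `T³` the spectrum of `A` is
  discrete, so "spectrum in the right half plane" means exactly this): a smooth steady state whose
  linearisation `L(ν, u_S)` (`Torus.IsLinNSEigenvalue`, classical point spectrum with pressure,
  equal to the point spectrum of `A` by elliptic regularity — see `LinearizedNSTorus`) has an
  eigenvalue `μ` with `Re μ > 0` is Lyapunov unstable in the above sense.
  -- TODO(general form): `(L^q, L^p)` for all `1 < p < ∞`, `q > max(p, n)`, any dimension, bounded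
  domains and `ℝⁿ` (FPS06 Thm 2.2 / §4), mild solutions.

HONEST FRAMING (cell `ns-blowup`, human ruling D-0035): an instability statement, NOT a blow-up
statement; it implies none of Fefferman (A)/(B)/(C)/(D).
-/

noncomputable section

namespace Literature.Analysis.FluidPDE

namespace Torus

open Literature.Analysis.FunctionSpaces Set

/-- **Lyapunov (nonlinear) instability of a steady state `u_S` of `NS_ν(f)` on `T³`, classical
form** (Friedlander–Pavlović–Shvydkoy 2006, Def. 2.1 with `Z = L²` measured by the kinetic energy
`E(v) = ½∫|v|²`, data `C^∞`-small as on their p. 7, solutions classical; loss of global existence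
counts as instability): `∃ ρ > 0, ∀ δ > 0, ∃ v₀` smooth, divergence free, `E(v₀) < δ`, such that
every global classical solution `(u, p)` of `NS_ν(f)` on `[0, ∞) × T³` with `u(0) = u_S + v₀` has
`E(u(t) − u_S) ≥ ρ` for some `t ≥ 0`. [cite: FriedlanderPavlovicShvydkoy2006, Def. 2.1 p. 4 and remark p. 7] -/
def IsLyapunovUnstableSteadyState (ν : ℝ)
    (f uS : UnitAddTorus (Fin 3) → EuclideanSpace ℝ (Fin 3)) : Prop :=
  ∃ ρ : ℝ, 0 < ρ ∧ ∀ δ : ℝ, 0 < δ →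
    ∃ v₀ : UnitAddTorus (Fin 3) → EuclideanSpace ℝ (Fin 3),
      Torus.IsSmooth v₀ ∧ Torus.IsDivFree v₀ ∧ Torus.kineticEnergy v₀ < δ ∧
      ∀ (u : ℝ → UnitAddTorus (Fin 3) → EuclideanSpace ℝ (Fin 3)) (p : ℝ → UnitAddTorus (Fin 3) → ℝ),
        Torus.IsClassicalNSSolutionOn (Ici 0) ν (fun _ => f) u p →
        u 0 = (fun x => uS x + v₀ x) →
        ∃ t : ℝ, 0 ≤ t ∧ ρ ≤ Torus.kineticEnergy (fun x => u t x - uS x)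

/-- **Friedlander–Pavlović–Shvydkoy 2006, Theorem 2.2 (linear ⇒ nonlinear instability), `T³`,
`p = 2`, eigenvalue form.** If `u_S` is a smooth steady state of the forced Navier–Stokes system
`NS_ν(f)` on `T³` (`ν > 0`, `f` smooth) and the linearised operator
`L(ν, u_S) w = νΔw − (u_S·∇)w − (w·∇)u_S − ∇q` has an eigenvalue `μ` with `Re μ > 0` (classical
point spectrum `Torus.IsLinNSEigenvalue`; on `T³` the spectrum is discrete and consists of such
eigenvalues, with smooth eigenfunctions), then `u_S` is Lyapunov unstable
(`Torus.IsLyapunovUnstableSteadyState`). Special case of the printed `(L^q, L^p)` statement, read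
with the `C^∞`-small datum `εφ` of the proof (p. 7).
-- TODO(general form): all `1 < p < ∞`, `q > max(p,n)`, any `n`, bounded domains / `ℝⁿ`, mild solutions.
[cite: FriedlanderPavlovicShvydkoy2006, Thm. 2.2 p. 4; §3 pp. 6–7] -/
def fps2006_nonlinear_instability_of_eigenvalue : Prop :=
  ∀ (ν : ℝ), 0 < ν →
  ∀ (f uS : UnitAddTorus (Fin 3) → EuclideanSpace ℝ (Fin 3)) (pS : UnitAddTorus (Fin 3) → ℝ),
    Torus.IsSteadyNSState ν f uS pS →
    (∃ μ : ℂ, 0 < μ.re ∧ Torus.IsLinNSEigenvalue ν uS μ) →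
    Torus.IsLyapunovUnstableSteadyState ν f uS

end Torus

end Literature.Analysis.FluidPDE
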